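import Summits.Ventures.PercRepro.C041TriDomK4

/-!
# ROW C-041 — THE TRIANGLE IS SHARP: none of its manifest terms can be dropped (p6, gen 39; P6-TWOEXIT-LEAN.md §51)

THE TRIANGLE IDENTITY (`thetaTri_eq_sum`) writes `θ_△(w, w′) = Q′(w, w′) + ℓψ(w w′) + ℓψ(w)·w′ + w·ℓψ(w′)` with the
«apart excess» `Q′(w, w′) := θ_B(w)θ_B(w′) + θ_R(w)θ_R(w′)` (one «both merged, unreached» colouring and the «both separated,
apart» one); every two-exit core's block map is a non-negative combination of these four kinds of term, of `w w′`, and of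
tree maps, with the multiplicities of the complementation classes (P6-TWOEXIT-LEAN.md §51).  The dominated cores
(`C041TriDomK4`, `C041TriDomCores5A–D`) are those where the apart excess is covered by whole triangles.  THE PARTIAL TRIANGLES
ARE NOT (P)-MAPS: `Q′`, `Q′ + ℓψ(w w′)` and `Q′ + ℓψ(w w′) + ℓψ(w)·w′` (the triangle with ONE manifest term removed) each violate
(P) at an explicit pair of cone members — single marked vertices and single leaves —
  `Q′(v 0, v 0 · v 1)`: `(g, t₁, t₂, k) = (7, 1, 3, 5)`, `(g − k)² = 4 > 3`;
  `(Q′ + ℓψ(w w′))(v 0, v ¾ · v ¾)`: `(2775/256, 369/128, 161/64, 2061/256)`, `(g − k)² = 714²/256² > 369·161/(128·64)`;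
  `(Q′ + ℓψ(w w′) + ℓψ(w) w′)(v 0 · v 0, v 1 · v 1 · v 1)`: `(50, 49, 9, 25)`, `625 > 441`
(`not_K4v_apartExcess`, `not_K4v_apartExcess_ellprod`, `not_K4v_thetaTri_sub`).  So the reduction of a core to the triangle by
domination cannot be pushed below the whole triangle: the 20 cores on `≤ 5` vertices that are not dominated (the diamonds
`K₄ − uu′`, `K₄ − au` and 18 five-vertex cores) need (P) for a partial triangle, which is false — their cone forms are
genuinely separate statements (the diamonds' (P) is THEOREM (RELAXED D1 / D2), gen 38, by certificates).
-/

namespace PercRepro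

namespace ZoneZ

namespace MultiExit

open TreeClosure RelaxedTriangle

/-- The apart excess `Q′(w, w′) = θ_B(w)θ_B(w′) + θ_R(w)θ_R(w′)`. -/
def apartExcess (w w' : Vec6) : Vec6 := thB w * thB w' + thR w * thR w'

/-- The triangle is the apart excess plus its three manifest terms. -/
theorem thetaTri_eq_apartExcess (w w' : Vec6) :
    thetaTri w w' = apartExcess w w' + ellv (w * w') + ellv w * w' + w * ellv w' := by
  ext i
  simp only [thetaTri_eq_sum, apartExcess, Pi.add_apply, Pi.mul_apply, thB, thR, ellv, ell, nAdm, kInv]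
  fin_cases i <;> simp <;> ring

/-- `Q′(v 0, v 0 · v 1)` violates (P): `(g, t₁, t₂, k) = (7, 1, 3, 5)` and `(g − k)² = 4 > 3 = t₁ t₂`. -/
theorem not_K4v_apartExcess : ¬ K4v (apartExcess (v 0) (v 0 * v 1)) := by
  intro h
  unfold K4v at h
  have := h.cs
  simp [apartExcess, thB, thR, nAdm, kInv, v, Pi.mul_apply] at this
  norm_num at this

/-- `(Q′ + ℓψ(w w′))(v 0, v ¾ · v ¾)` violates (P). -/
theorem not_K4v_apartExcess_ellprod :
    ¬ K4v (apartExcess (v 0) (v (3 / 4) * v (3 / 4)) + ellv (v 0 * (v (3 / 4) * v (3 / 4)))) := by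
  intro h
  unfold K4v at h
  have := h.cs
  simp [apartExcess, thB, thR, nAdm, kInv, ellv, ell, v, Pi.mul_apply] at this
  norm_num at this

/-- **THE TRIANGLE MINUS ONE MANIFEST TERM IS NOT A (P)-MAP**: `θ_△(v 0 · v 0, v 1 · v 1 · v 1) − (v 0 · v 0) · ℓψ(v 1 · v 1 · v 1)` violates (P):
`(g, t₁, t₂, k) = (50, 49, 9, 25)` and `625 > 441`. -/
theorem not_K4v_thetaTri_sub :
    ¬ K4v (apartExcess (v 0 * v 0) (v 1 * (v 1 * v 1)) + ellv (v 0 * v 0 * (v 1 * (v 1 * v 1)))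
      + ellv (v 0 * v 0) * (v 1 * (v 1 * v 1))) := by
  intro h
  unfold K4v at h
  have := h.cs
  simp [apartExcess, thB, thR, nAdm, kInv, ellv, ell, v, Matrix.vecHead, Matrix.vecTail, Pi.mul_apply] at this
  norm_num at this

/-- The inputs of the witnesses are cone members: `v 0`, `v 0 · v 1`, `v ¾ · v ¾`, `v 0 · v 0`, `v 1 · v 1 · v 1`. -/
theorem InCone_witness_inputs :
    InCone (v 0) ∧ InCone (v 0 * v 1) ∧ InCone (v (3 / 4) * v (3 / 4)) ∧ InCone (v 0 * v 0) ∧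
      InCone (v 1 * (v 1 * v 1)) :=
  have h0 : InCone (v 0) := InCone_v 0 ⟨le_rfl, zero_le_one⟩
  have h1 : InCone (v 1) := InCone_v 1 ⟨zero_le_one, le_rfl⟩
  have h34 : InCone (v (3 / 4)) := InCone_v (3 / 4) ⟨by norm_num, by norm_num⟩
  ⟨h0, h0.mul h1, h34.mul h34, h0.mul h0, h1.mul (h1.mul h1)⟩

end MultiExit

end ZoneZ

end PercRepro
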